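import Summits.AtomisticToContinuum.HydrodynamicLimit.Theses.JParityClosure
import Literature.MathematicalPhysics.KineticTheory.HardSphereEulerProofs
import Literature.MathematicalPhysics.KineticTheory.HardSphereUniformGas
import Literature.Analysis.FunctionSpaces.TorusGridCellsGeometry
import HarnessLib

/-!
# Tagged-particle void estimate from the fixed-ball one (V2 of P4)

Crux `JParityClosure.OddContactSymmetry` (stmt-AtomisticToContinuum-17722), line `KineticSlabSketch`,
registered stub `stub_taggedVoid_of`: under the uniform configurational canonical hard-sphere measure
`posGibbsMeasure 1 ε_N (N+1)`, the probability that the `R`-ball around the TAGGED particle `j` holds at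
most `(N+1)R³/512` particles is small, GIVEN the same statement for FIXED balls (hypothesis V1, radius
`R/2`, threshold `(N+1)(R/2)³/64 = (N+1)R³/512`).

Proof. (a) EXCHANGEABILITY: the measure is invariant under relabelling `x ↦ x ∘ τ`
(`posGibbs_preimage_comp_perm`), so `P(occ_j ≤ T)` does not depend on `j` and
`(N+1) P(occ_j ≤ T) = Σ_l P(occ_l ≤ T) = E #{l | occ_l ≤ T}`. (b) GRID: the `m³` projected corners
`q` of the grid cubes of mesh `1/m`, `m = ⌈4/R⌉ ≤ 5/R`, are `√3/m < R/2`-dense (`exists_gridCorner_near`);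
if `x_l` is within `R/2` of `q` and `occ_l ≤ T` then the `R/2`-ball count at `q` is `≤ occ_l ≤ T`
(triangle inequality) and the number of such `l` is itself at most that ball count, so pointwise
`#{l | occ_l ≤ T} ≤ T · #{q | ballcount(q, R/2) ≤ T}` (`card_sparse_le_mul_card`). (c) Taking
expectations (`sum_measure_le_mul_sum_measure`) and using V1 for each of the `m³ ≤ 125/R³` corners,
`(N+1) P(occ_j ≤ T) ≤ T · m³ · y ≤ (125/512)(N+1) y`.
-/

noncomputable section

open scoped BigOperators Classical InnerProductSpace ENNReal Topology
open Set MeasureTheory Filter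
open Literature.Analysis.FluidPDE Literature.MathematicalPhysics.KineticTheory

namespace Summit.AtomisticToContinuum.HydrodynamicLimit.Theorems.OddContactSymmetryKineticSlab

/-! ### Exchangeability of the uniform canonical hard-sphere measure -/

/-- **Exchangeability.** The uniform configurational canonical measure `posGibbsMeasure 1 ε n` is
invariant under every relabelling `x ↦ x ∘ τ` of the particles, `τ` a permutation of `Fin n`: the
product reference measure is relabelling invariant (`measurePreserving_piCongrLeft`) and so is the
non-overlap set `posDomain`. [folklore] -/
theorem posGibbs_preimage_comp_perm (ε : ℝ) (n : ℕ) (τ : Equiv.Perm (Fin n))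
    {S : Set (Fin n → T3)} (hS : MeasurableSet S) :
    posGibbsMeasure (fun _ : T3 => (1 : ℝ)) ε n ((fun x : Fin n → T3 => x ∘ τ) ⁻¹' S) =
      posGibbsMeasure (fun _ : T3 => (1 : ℝ)) ε n S := by
  set P := profileOf (fun _ : T3 => (1 : ℝ)) continuous_const (fun _ => one_pos) with hP
  have hν : MeasurePreserving (fun x : Fin n → T3 => x ∘ τ) (Measure.pi fun _ : Fin n => P.μ)
      (Measure.pi fun _ : Fin n => P.μ) :=
    (measurePreserving_piCongrLeft (fun _ : Fin n => P.μ) τ).symm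
  have hD : (fun x : Fin n → T3 => x ∘ τ) ⁻¹' posDomain ε n = posDomain ε n := by
    ext x
    simp only [mem_preimage, posDomain, mem_setOf_eq, Function.comp_apply]
    constructor
    · intro h i j hij
      have h' := h (τ.symm i) (τ.symm j) (by simpa using hij)
      simpa using h'
    · intro h i j hij
      exact h _ _ (τ.injective.ne hij)
  have h1 : (fun x : Fin n → T3 => x ∘ τ) ⁻¹' S ∩ posDomain ε n =
      (fun x : Fin n → T3 => x ∘ τ) ⁻¹' (S ∩ posDomain ε n) := by
    rw [preimage_inter, hD]
  rw [posGibbsMeasure_eq continuous_const (fun _ => one_pos) ε n, hardCoreSet_ov_univ,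
    Measure.smul_apply, Measure.smul_apply, Measure.restrict_apply (hS.preimage hν.measurable),
    Measure.restrict_apply hS, h1,
    hν.measure_preimage (hS.inter (measurableSet_posDomain ε n)).nullMeasurableSet]

/-- Relabelling by the transposition `(j l)` carries the event "the `R`-ball around the tagged
particle `j` holds at most `T` particles" to the same event for the tagged particle `l`. [folklore] -/
theorem preimage_comp_swap_setOf_ballCount_le {n : ℕ} (j l : Fin n) (R T : ℝ) :
    (fun x : Fin n → T3 => x ∘ (Equiv.swap j l)) ⁻¹'
        {x | ((Finset.univ.filter fun k : Fin n => Torus.euclidDist (x k) (x j) < R).card : ℝ) ≤ T} =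
      {x | ((Finset.univ.filter fun k : Fin n => Torus.euclidDist (x k) (x l) < R).card : ℝ) ≤ T} := by
  ext x
  simp only [mem_preimage, mem_setOf_eq, Function.comp_apply, Equiv.swap_apply_left]
  rw [Finset.card_equiv (Equiv.swap j l)
    (t := Finset.univ.filter fun k : Fin n => Torus.euclidDist (x k) (x l) < R) (fun k => by simp)]

/-! ### Measurability of ball counts -/

/-- The number of particles in the (minimal-image) `r`-ball around a measurably chosen centre is a
measurable function of the configuration. [folklore] -/
theorem measurable_ballCount_real {n : ℕ} {c : (Fin n → T3) → T3} (hc : Measurable c) (r : ℝ) :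
    Measurable fun x : Fin n → T3 =>
      ((Finset.univ.filter fun k : Fin n => Torus.euclidDist (x k) (c x) < r).card : ℝ) := by
  have hk : ∀ k : Fin n, Measurable fun x : Fin n → T3 => Torus.euclidDist (x k) (c x) := by
    intro k
    have h := continuous_euclidDist_prod.measurable.comp ((measurable_pi_apply k).prodMk hc)
    exact h
  have e : (fun x : Fin n → T3 =>
      ((Finset.univ.filter fun k : Fin n => Torus.euclidDist (x k) (c x) < r).card : ℝ)) =
      fun x => ∑ k : Fin n, if Torus.euclidDist (x k) (c x) < r then (1 : ℝ) else 0 := by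
    funext x
    exact Finset.natCast_card_filter _ _
  rw [e]
  exact Finset.measurable_sum _ fun k _ =>
    Measurable.ite (measurableSet_lt (hk k) measurable_const) measurable_const measurable_const

/-! ### From a pointwise count comparison to a comparison of expectations -/

/-- If pointwise the number of events `A k` containing `x` is at most `T` times the number of events
`B i` containing `x`, then `Σ_k μ(A k) ≤ T Σ_i μ(B i)` (linearity of the integral of indicators).
[folklore] -/
theorem sum_measure_le_mul_sum_measure {Ω : Type*} [MeasurableSpace Ω] (μ : Measure Ω)
    {κ ι : Type*} [Fintype κ] [Fintype ι] {A : κ → Set Ω} {B : ι → Set Ω}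
    (hA : ∀ k, MeasurableSet (A k)) (hB : ∀ i, MeasurableSet (B i)) {T : ℝ} (hT : 0 ≤ T)
    (h : ∀ x, ((Finset.univ.filter fun k => x ∈ A k).card : ℝ) ≤
      T * (Finset.univ.filter fun i => x ∈ B i).card) :
    ∑ k, μ (A k) ≤ ENNReal.ofReal T * ∑ i, μ (B i) := by
  calc ∑ k, μ (A k) = ∑ k, ∫⁻ x, (A k).indicator 1 x ∂μ := by simp_rw [lintegral_indicator_one (hA _)]
    _ = ∫⁻ x, ∑ k, (A k).indicator 1 x ∂μ :=
        (lintegral_finsetSum _ fun k _ => measurable_one.indicator (hA k)).symm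
    _ ≤ ∫⁻ x, ENNReal.ofReal T * ∑ i, (B i).indicator 1 x ∂μ := by
        refine lintegral_mono fun x => ?_
        simp only [Set.indicator_apply, Pi.one_apply, Finset.sum_boole]
        calc ((Finset.univ.filter fun k => x ∈ A k).card : ℝ≥0∞)
            = ENNReal.ofReal ((Finset.univ.filter fun k => x ∈ A k).card : ℝ) :=
              (ENNReal.ofReal_natCast _).symm
          _ ≤ ENNReal.ofReal (T * (Finset.univ.filter fun i => x ∈ B i).card) :=
              ENNReal.ofReal_le_ofReal (h x)
          _ = ENNReal.ofReal T * ((Finset.univ.filter fun i => x ∈ B i).card : ℝ≥0∞) := by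
              rw [ENNReal.ofReal_mul hT, ENNReal.ofReal_natCast]
    _ = ENNReal.ofReal T * ∑ i, μ (B i) := by
        rw [lintegral_const_mul _ (Finset.measurable_sum _ fun i _ => measurable_one.indicator (hB i)),
          lintegral_finsetSum _ fun i _ => measurable_one.indicator (hB i)]
        simp_rw [lintegral_indicator_one (hB _)]

/-! ### The grid covering and the pigeonhole count -/

section Grid

open Literature.Analysis.FunctionSpaces.Torus (proj repr latticeVec finIndex unitCube
  iUnion_gridCell_eq_unitCube norm_sub_le_of_mem_gridCell repr_mem_unitCube proj_repr)

/-- **The grid corners are `√3/m`-dense.** Every point of `𝕋³` is within minimal-image distance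
`√3 / m` of the projection of a corner `j/m`, `j ∈ {0,…,m-1}³`, of the grid of mesh `1/m`: its
fundamental-domain representative lies in one of the grid cubes (`iUnion_gridCell_eq_unitCube`), whose
diameter is `√3/m`, and the projection does not increase distances. [folklore] -/
theorem exists_gridCorner_near {m : ℕ} (hm : 0 < m) (p : T3) :
    ∃ jj : Fin 3 → Fin m, Torus.euclidDist p
      (proj (((m : ℝ))⁻¹ • latticeVec (finIndex jj))) ≤ Real.sqrt 3 / m := by
  have hyU : repr p ∈ unitCube (Fin 3) := repr_mem_unitCube p
  rw [← iUnion_gridCell_eq_unitCube hm, mem_iUnion] at hyU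
  obtain ⟨jj, hjj⟩ := hyU
  refine ⟨jj, ?_⟩
  have hz : (m : ℝ) • (((m : ℝ))⁻¹ • latticeVec (finIndex jj) : EuclideanSpace ℝ (Fin 3)) -
      latticeVec (finIndex jj) ∈ unitCube (Fin 3) := by
    rw [smul_smul, mul_inv_cancel₀ (by exact_mod_cast hm.ne'), one_smul, sub_self]
    intro i
    simp
  have hdist := norm_sub_le_of_mem_gridCell hm hjj hz
  rw [Fintype.card_fin, Nat.cast_ofNat] at hdist
  calc Torus.euclidDist p (proj (((m : ℝ))⁻¹ • latticeVec (finIndex jj)))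
      = Torus.euclidDist (proj (repr p)) (proj (((m : ℝ))⁻¹ • latticeVec (finIndex jj))) := by
        rw [proj_repr]
    _ ≤ ‖repr p - ((m : ℝ))⁻¹ • latticeVec (finIndex jj)‖ := by
        simpa using Torus.euclidDist_translate_le (0 : T3) 0 (repr p)
          (((m : ℝ))⁻¹ • latticeVec (finIndex jj))
    _ ≤ Real.sqrt 3 / m := hdist

end Grid

/-- **Pigeonhole on the grid.** If every point of `𝕋³` is within `R/2` of its assigned centre
`q (jc ·)`, then the number of particles `l` whose `R`-ball holds at most `T` particles is at most `T`
times the number of centres whose `R/2`-ball holds at most `T` particles: the `R/2`-ball of the centre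
assigned to such an `x_l` lies in the `R`-ball of `x_l` (so the centre is sparse), and it contains every
particle assigned to that centre (so there are at most `T` of them). [folklore] -/
theorem card_sparse_le_mul_card {n : ℕ} {ι : Type*} [Fintype ι] (q : ι → T3) {R T : ℝ} (hT : 0 ≤ T)
    {jc : T3 → ι} (hjc : ∀ p : T3, Torus.euclidDist p (q (jc p)) < R / 2) (x : Fin n → T3) :
    ((Finset.univ.filter fun l : Fin n =>
        ((Finset.univ.filter fun k : Fin n => Torus.euclidDist (x k) (x l) < R).card : ℝ) ≤ T).card : ℝ) ≤
      T * ((Finset.univ.filter fun i : ι =>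
        ((Finset.univ.filter fun k : Fin n => Torus.euclidDist (x k) (q i) < R / 2).card : ℝ) ≤ T).card :
          ℝ) := by
  set S := Finset.univ.filter fun l : Fin n =>
    ((Finset.univ.filter fun k : Fin n => Torus.euclidDist (x k) (x l) < R).card : ℝ) ≤ T with hS
  set G := Finset.univ.filter fun i : ι =>
    ((Finset.univ.filter fun k : Fin n => Torus.euclidDist (x k) (q i) < R / 2).card : ℝ) ≤ T with hG
  have hfib : S.card = ∑ i : ι, (S.filter fun l => jc (x l) = i).card :=
    Finset.card_eq_sum_card_fiberwise fun l _ => Finset.mem_coe.2 (Finset.mem_univ _)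
  have hle : ∀ i, ((S.filter fun l => jc (x l) = i).card : ℝ) ≤ if i ∈ G then T else 0 := by
    intro i
    rcases (S.filter fun l => jc (x l) = i).eq_empty_or_nonempty with h0 | ⟨l₀, hl₀⟩
    · rw [h0, Finset.card_empty, Nat.cast_zero]
      split_ifs
      · exact hT
      · exact le_rfl
    · rw [Finset.mem_filter] at hl₀
      have hS₀ : ((Finset.univ.filter fun k : Fin n => Torus.euclidDist (x k) (x l₀) < R).card : ℝ) ≤ T :=
        (Finset.mem_filter.1 hl₀.1).2
      have hq₀ : Torus.euclidDist (x l₀) (q i) < R / 2 := by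
        have h1 := hjc (x l₀)
        rwa [hl₀.2] at h1
      have hsub1 : (Finset.univ.filter fun k : Fin n => Torus.euclidDist (x k) (q i) < R / 2) ⊆
          Finset.univ.filter fun k : Fin n => Torus.euclidDist (x k) (x l₀) < R := by
        intro k hk
        rw [Finset.mem_filter] at hk ⊢
        refine ⟨Finset.mem_univ _, ?_⟩
        calc Torus.euclidDist (x k) (x l₀)
            ≤ Torus.euclidDist (x k) (q i) + Torus.euclidDist (q i) (x l₀) := euclidDist_triangle _ _ _
          _ < R / 2 + R / 2 := add_lt_add hk.2 (by rwa [Torus.euclidDist_comm])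
          _ = R := by ring
      have hiG : i ∈ G := by
        rw [hG, Finset.mem_filter]
        refine ⟨Finset.mem_univ _, le_trans ?_ hS₀⟩
        exact_mod_cast Finset.card_le_card hsub1
      rw [if_pos hiG]
      have hsub2 : (S.filter fun l => jc (x l) = i) ⊆
          Finset.univ.filter fun k : Fin n => Torus.euclidDist (x k) (q i) < R / 2 := by
        intro l hl
        rw [Finset.mem_filter] at hl ⊢
        refine ⟨Finset.mem_univ _, ?_⟩
        have h1 := hjc (x l)
        rwa [hl.2] at h1
      calc ((S.filter fun l => jc (x l) = i).card : ℝ)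
          ≤ ((Finset.univ.filter fun k : Fin n => Torus.euclidDist (x k) (q i) < R / 2).card : ℝ) := by
            exact_mod_cast Finset.card_le_card hsub2
        _ ≤ ((Finset.univ.filter fun k : Fin n => Torus.euclidDist (x k) (x l₀) < R).card : ℝ) := by
            exact_mod_cast Finset.card_le_card hsub1
        _ ≤ T := hS₀
  calc (S.card : ℝ) = ∑ i : ι, ((S.filter fun l => jc (x l) = i).card : ℝ) := by
        rw [hfib]; push_cast; rfl
    _ ≤ ∑ i : ι, (if i ∈ G then T else 0) := Finset.sum_le_sum fun i _ => hle i
    _ = ∑ _i ∈ G, T := by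
        rw [← Finset.sum_filter]
        congr 1
        ext i
        simp
    _ = T * G.card := by rw [Finset.sum_const, nsmul_eq_mul, mul_comm]

/-! ### The stub -/

/-- **V2: tagged-particle void estimate from the fixed-ball one** (grid + exchangeability). Under the
uniform configurational canonical hard-sphere measure at reduced density `σ ≤ σ₀`, for
`1024 ε_N ≤ R ≤ 1/8` and `(N+1)R³ ≥ n₀`, the probability that the `R`-ball around the tagged particle
`j` holds at most `(N+1)R³/512` particles is at most `y`, given the fixed-ball statement V1.
[folklore] -/
theorem stub_taggedVoid_of :
    (∃ σ₀ : ℝ, 0 < σ₀ ∧ ∀ {σ : ℝ} (_hσ : 0 < σ) (_hσ0 : σ ≤ σ₀) (y : ℝ) (_hy : 0 < y),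
    ∃ n₀ : ℝ, ∀ {N : ℕ} {R : ℝ} (_hR : 512 * hsDiameter σ N ≤ R) (_hR4 : R ≤ 1 / 4)
      (_hn : n₀ ≤ ((N : ℝ) + 1) * R ^ 3) (c : UnitAddTorus (Fin 3)),
      posGibbsMeasure (fun _ : T3 => (1 : ℝ)) (hsDiameter σ N) (N + 1)
          {x | ((Finset.univ.filter fun k : Fin (N + 1) => Torus.euclidDist (x k) c < R).card : ℝ) ≤
            ((N : ℝ) + 1) * R ^ 3 / 64} ≤ ENNReal.ofReal y) →
    ∃ σ₀ : ℝ, 0 < σ₀ ∧ ∀ {σ : ℝ} (_hσ : 0 < σ) (_hσ0 : σ ≤ σ₀) (y : ℝ) (_hy : 0 < y),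
    ∃ n₀ : ℝ, ∀ {N : ℕ} {R : ℝ} (_hR : 1024 * hsDiameter σ N ≤ R) (_hR8 : R ≤ 1 / 8)
      (_hn : n₀ ≤ ((N : ℝ) + 1) * R ^ 3) (j : Fin (N + 1)),
      posGibbsMeasure (fun _ : T3 => (1 : ℝ)) (hsDiameter σ N) (N + 1)
          {x | ((Finset.univ.filter fun k : Fin (N + 1) => Torus.euclidDist (x k) (x j) < R).card : ℝ) ≤
            ((N : ℝ) + 1) * R ^ 3 / 512} ≤ ENNReal.ofReal y := by
  rintro ⟨σ₁, hσ₁, hV⟩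
  refine ⟨min σ₁ (1 / 2), lt_min hσ₁ (by norm_num), ?_⟩
  intro σ hσ hσ0 y hy
  obtain ⟨n₁, hn₁⟩ := hV hσ (hσ0.trans (min_le_left _ _)) y hy
  refine ⟨8 * n₁, ?_⟩
  intro N R hR hR8 hn j
  have hσ2 : σ ≤ 1 / 2 := hσ0.trans (min_le_right _ _)
  have hε : 0 < hsDiameter σ N := hsDiameter_pos hσ N
  have hRpos : 0 < R := by linarith
  haveI : IsProbabilityMeasure (posGibbsMeasure (fun _ : T3 => (1 : ℝ)) (hsDiameter σ N) (N + 1)) :=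
    isProbabilityMeasure_posGibbsMeasure continuous_const (fun _ => one_pos) hσ2 N
  -- the grid of mesh `1/m`, `4/R ≤ m ≤ 5/R`
  obtain ⟨m, hm4, hm5⟩ : ∃ m : ℕ, 4 / R ≤ m ∧ (m : ℝ) * R ≤ 5 := by
    refine ⟨⌈4 / R⌉₊, Nat.le_ceil _, ?_⟩
    have h1 : (⌈4 / R⌉₊ : ℝ) < 4 / R + 1 := Nat.ceil_lt_add_one (by positivity)
    have h2 : (4 / R + 1) * R = 4 + R := by field_simp
    nlinarith [mul_lt_mul_of_pos_right h1 hRpos]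
  have hmR4 : 4 ≤ (m : ℝ) * R := by rwa [div_le_iff₀ hRpos] at hm4
  have hmpos' : (0 : ℝ) < m := by nlinarith
  have hmpos : 0 < m := by exact_mod_cast hmpos'
  -- the centres and the covering
  set q : (Fin 3 → Fin m) → T3 := fun jj => Literature.Analysis.FunctionSpaces.Torus.proj
    (((m : ℝ))⁻¹ • Literature.Analysis.FunctionSpaces.Torus.latticeVec
      (Literature.Analysis.FunctionSpaces.Torus.finIndex jj)) with hq
  have hcover : ∀ p : T3, ∃ jj : Fin 3 → Fin m, Torus.euclidDist p (q jj) < R / 2 := by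
    intro p
    obtain ⟨jj, hjj⟩ := exists_gridCorner_near hmpos p
    refine ⟨jj, lt_of_le_of_lt hjj ?_⟩
    have h3 : Real.sqrt 3 < 2 := (Real.sqrt_lt' two_pos).2 (by norm_num)
    rw [div_lt_div_iff₀ hmpos' two_pos]
    nlinarith [Real.sqrt_nonneg 3]
  choose jc hjc using hcover
  -- the threshold and the events
  set T : ℝ := ((N : ℝ) + 1) * R ^ 3 / 512 with hT
  have hT0 : 0 ≤ T := by positivity
  obtain ⟨A, hA⟩ : ∃ A : Fin (N + 1) → Set (Fin (N + 1) → T3), ∀ l, A l =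
      {x | ((Finset.univ.filter fun k : Fin (N + 1) => Torus.euclidDist (x k) (x l) < R).card : ℝ) ≤ T} :=
    ⟨_, fun _ => rfl⟩
  obtain ⟨B, hB⟩ : ∃ B : (Fin 3 → Fin m) → Set (Fin (N + 1) → T3), ∀ jj, B jj =
      {x | ((Finset.univ.filter fun k : Fin (N + 1) => Torus.euclidDist (x k) (q jj) < R / 2).card : ℝ) ≤
        T} :=
    ⟨_, fun _ => rfl⟩
  rw [← hA j]
  set μ := posGibbsMeasure (fun _ : T3 => (1 : ℝ)) (hsDiameter σ N) (N + 1) with hμ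
  have hAm : ∀ l, MeasurableSet (A l) := fun l => by
    rw [hA]
    exact measurableSet_le (measurable_ballCount_real (measurable_pi_apply l) R) measurable_const
  have hBm : ∀ jj, MeasurableSet (B jj) := fun jj => by
    rw [hB]
    exact measurableSet_le (measurable_ballCount_real measurable_const (R / 2)) measurable_const
  -- (a) exchangeability
  have h1 : ∀ l, μ (A l) = μ (A j) := fun l => by
    have hAj := hAm j
    rw [hA j] at hAj
    rw [hA l, hA j, ← preimage_comp_swap_setOf_ballCount_le j l R T]
    exact posGibbs_preimage_comp_perm _ _ (Equiv.swap j l) hAj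
  -- (c) the fixed-ball estimate at the corners, radius `R/2`
  have h2 : ∀ jj, μ (B jj) ≤ ENNReal.ofReal y := fun jj => by
    have hR' : 512 * hsDiameter σ N ≤ R / 2 := by linarith
    have hR4' : R / 2 ≤ 1 / 4 := by linarith
    have hn' : n₁ ≤ ((N : ℝ) + 1) * (R / 2) ^ 3 := by nlinarith
    have hthr : ((N : ℝ) + 1) * (R / 2) ^ 3 / 64 = T := by rw [hT]; ring
    have h := hn₁ hR' hR4' hn' (q jj)
    rw [hthr] at h
    rw [hB]
    exact h
  -- (b) the pigeonhole count, pointwise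
  have h3 : ∀ x : Fin (N + 1) → T3, ((Finset.univ.filter fun l => x ∈ A l).card : ℝ) ≤
      T * (Finset.univ.filter fun jj => x ∈ B jj).card := by
    intro x
    have h := card_sparse_le_mul_card q hT0 hjc x (n := N + 1)
    simp only [hA, hB, mem_setOf_eq]
    convert h using 2
  have h4 : ∑ l, μ (A l) ≤ ENNReal.ofReal T * ∑ jj, μ (B jj) :=
    sum_measure_le_mul_sum_measure μ hAm hBm hT0 h3
  -- assembling
  have hreal : T * ((m : ℝ) ^ 3 * y) ≤ ((N + 1 : ℕ) : ℝ) * y := by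
    have hmR3 : ((m : ℝ) * R) ^ 3 ≤ 125 := by
      calc ((m : ℝ) * R) ^ 3 ≤ 5 ^ 3 := pow_le_pow_left₀ (by positivity) hm5 3
        _ = 125 := by norm_num
    have e : T * ((m : ℝ) ^ 3 * y) = ((N : ℝ) + 1) * y * (((m : ℝ) * R) ^ 3 / 512) := by
      rw [hT]; ring
    rw [e, Nat.cast_succ]
    have hNy : 0 ≤ ((N : ℝ) + 1) * y := by positivity
    calc ((N : ℝ) + 1) * y * (((m : ℝ) * R) ^ 3 / 512) ≤ ((N : ℝ) + 1) * y * 1 := by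
          gcongr; linarith
      _ = ((N : ℝ) + 1) * y := mul_one _
  have h5 : ((N + 1 : ℕ) : ℝ≥0∞) * μ (A j) ≤ ((N + 1 : ℕ) : ℝ≥0∞) * ENNReal.ofReal y := by
    calc ((N + 1 : ℕ) : ℝ≥0∞) * μ (A j) = ∑ l : Fin (N + 1), μ (A l) := by
          rw [Finset.sum_congr rfl fun l _ => h1 l, Finset.sum_const, Finset.card_univ, Fintype.card_fin,
            nsmul_eq_mul]
      _ ≤ ENNReal.ofReal T * ∑ jj : Fin 3 → Fin m, μ (B jj) := h4
      _ ≤ ENNReal.ofReal T * ∑ _jj : Fin 3 → Fin m, ENNReal.ofReal y := by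
          gcongr with jj _
          exact h2 jj
      _ = ENNReal.ofReal T * (((m ^ 3 : ℕ) : ℝ≥0∞) * ENNReal.ofReal y) := by
          rw [Finset.sum_const, Finset.card_univ, Fintype.card_fun, Fintype.card_fin, Fintype.card_fin,
            nsmul_eq_mul]
      _ = ENNReal.ofReal (T * ((m : ℝ) ^ 3 * y)) := by
          rw [ENNReal.ofReal_mul hT0, ENNReal.ofReal_mul (by positivity), ← ENNReal.ofReal_natCast,
            Nat.cast_pow]
      _ ≤ ENNReal.ofReal (((N + 1 : ℕ) : ℝ) * y) := ENNReal.ofReal_le_ofReal hreal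
      _ = ((N + 1 : ℕ) : ℝ≥0∞) * ENNReal.ofReal y := by
          rw [ENNReal.ofReal_mul (by positivity), ENNReal.ofReal_natCast]
  exact (ENNReal.mul_le_mul_iff_right (by simp) (ENNReal.natCast_ne_top _)).1 h5

end Summit.AtomisticToContinuum.HydrodynamicLimit.Theorems.OddContactSymmetryKineticSlab

end
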